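import Mathlib
import HarnessLib
import Summits.CriticalPhenomena.Ising3DConformalLimit.Theorems.HyperoctahedralRPTwoPointKernelOfLimitClauses
import Literature.Probability.LatticeModels.HighDimPointwiseTriviality

/-!
# Vague asymptotic isotropy of the critical `ℤ³` two-point function from a scale-covariant limit, I:
# lattice sums as integrals of step functions, orthogonal matrices as isometries
(route HarmonicMomentsIsotropy, support item stmt-CriticalPhenomena-6036 `TwoPointAsymptoticIsotropy`;
helper file, conditional line `ExistsScaleCovariantLimit → TwoPointAsymptoticIsotropy`)

The milestone `TwoPointAsymptoticIsotropy` (lattice, test-function form of the `O(3)`-invariance of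
`⟨σ₀σ_x⟩_{β_c}` on `ℤ³`) is derived in this line from the shared crux `ExistsScaleCovariantLimit`
(item stmt-CriticalPhenomena-1981) and the tree's continuum two-point isotropy
(`HyperoctahedralRPTwoPoint.kernel_rotation_invariant`, nine-mirror RP rigidity). This first file holds
the model-free bookkeeping:

* `integral_comp_latticeApprox` — for a finitely supported `F : ℤ³ → ℝ` and mesh `δ > 0`,
  `∫_{ℝ³} F([y/δ]) dy = δ³ Σ_x F(x)` (the cells `{[y/δ] = x}` are half-open cubes of volume `δ³`);
* `cube_mul_tsum_eq_integral` — hence `δ³ Σ_x Ψ(δx) g(x) = ∫ Ψ(δ[y/δ]) g([y/δ]) dy` for every `Ψ`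
  vanishing outside a ball (the lattice sum is finite);
* `exists_linearIsometryEquiv_of_orthogonal` — an orthogonal `3 × 3` matrix acts on
  `EuclideanSpace ℝ (Fin 3)` as a linear isometry (`Rᵀ R = 1` preserves the dot product).

References: H. Duminil-Copin, ICM 2022, §8.1 (rotation invariance on `ℤ³` is open; this line makes the
lattice statement a consequence of the existence of a scale-covariant limit); G. B. Folland, *Real
Analysis* (1999), Thm. 2.26/2.28 (Riemann sums of step functions). No definitions are introduced.
-/

noncomputable section

namespace Summit.CriticalPhenomena.Ising3DConformalLimit.HarmonicMomentsIsotropyTwoPoint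

open Literature.Probability.LatticeModels MeasureTheory Filter Set
open scoped Topology

/-! ### Lattice sites, sup norms and rescaled Euclidean norms -/

/-- A finitely supported lattice function has `∑' = ∑` over a box containing the support. [folklore] -/
theorem tsum_eq_sum_box {f : Site 3 → ℝ} {N : ℕ} (h : ∀ x, N < Site.supNorm x → f x = 0) :
    ∑' x, f x = ∑ x ∈ box 3 N, f x :=
  tsum_eq_sum fun x hx => h x (by rwa [mem_box_iff_supNorm_le, not_le] at hx)

/-- A lattice function vanishing off a box is summable. [folklore] -/
theorem summable_of_box {f : Site 3 → ℝ} {N : ℕ} (h : ∀ x, N < Site.supNorm x → f x = 0) :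
    Summable f :=
  summable_of_ne_finset_zero (s := box 3 N) fun x hx =>
    h x (by rwa [mem_box_iff_supNorm_le, not_le] at hx)

/-- Coordinates are bounded by the Euclidean norm: `|δ x_i| ≤ ‖δ x‖`. [folklore] -/
theorem abs_smul_coord_le_norm (δ : ℝ) (x : Site 3) (i : Fin 3) :
    |δ * (x i : ℝ)| ≤ ‖δ • siteVec x‖ := by
  have h := PiLp.norm_apply_le (δ • siteVec x) i
  rwa [WithLp.ofLp_smul, Pi.smul_apply, smul_eq_mul, Real.norm_eq_abs] at h

/-- If `‖δ x‖ ≤ M` (Euclidean norm, `δ > 0`) then `‖x‖_∞ ≤ ⌈M/δ⌉`. [folklore] -/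
theorem supNorm_le_ceil_of_norm_smul_le {δ M : ℝ} (hδ : 0 < δ) {x : Site 3}
    (hx : ‖δ • siteVec x‖ ≤ M) : Site.supNorm x ≤ ⌈M / δ⌉₊ := by
  have hM : 0 ≤ M := (norm_nonneg _).trans hx
  have hcoord : ∀ i, |(x i : ℝ)| ≤ M / δ := fun i => by
    have h := (abs_smul_coord_le_norm δ x i).trans hx
    rw [abs_mul, abs_of_pos hδ] at h
    rw [le_div_iff₀ hδ]
    linarith
  have hnorm : ‖x‖ ≤ M / δ := by
    rw [pi_norm_le_iff_of_nonneg (by positivity)]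
    intro i
    rw [Int.norm_eq_abs]
    exact hcoord i
  rw [Site.norm_eq_supNorm] at hnorm
  exact_mod_cast hnorm.trans (Nat.le_ceil _)

/-- A function `Ψ` on `ℝ³` vanishing outside the ball of radius `M`, sampled on `δℤ³` (`δ > 0`),
vanishes at the sites of sup norm `> ⌈M/δ⌉`. [folklore] -/
theorem sample_eq_zero_of_supNorm_lt {Ψ : EuclideanSpace ℝ (Fin 3) → ℝ} {M δ : ℝ} (hδ : 0 < δ)
    (hΨ : ∀ y, M < ‖y‖ → Ψ y = 0) (x : Site 3) (hx : ⌈M / δ⌉₊ < Site.supNorm x) :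
    Ψ (δ • siteVec x) = 0 := by
  by_contra h
  have hle : ‖δ • siteVec x‖ ≤ M := by
    by_contra h'
    exact h (hΨ _ (not_le.1 h'))
  exact absurd (supNorm_le_ceil_of_norm_smul_le hδ hle) (not_le.2 hx)

/-- The Euclidean norm on `ℝ³` is at most twice the sup norm of the coordinates. [folklore] -/
theorem norm_le_two_mul_norm_ofLp (z : EuclideanSpace ℝ (Fin 3)) : ‖z‖ ≤ 2 * ‖z.ofLp‖ := by
  have hsq : ‖z‖ ^ 2 = ∑ i, ‖z i‖ ^ 2 := EuclideanSpace.norm_sq_eq z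
  have hle : ∀ i, ‖z i‖ ^ 2 ≤ ‖z.ofLp‖ ^ 2 := fun i =>
    pow_le_pow_left₀ (norm_nonneg _) (norm_le_pi_norm z.ofLp i) 2
  have h3 : ‖z‖ ^ 2 ≤ (2 * ‖z.ofLp‖) ^ 2 := by
    calc ‖z‖ ^ 2 = ∑ i, ‖z i‖ ^ 2 := hsq
      _ ≤ ∑ _i : Fin 3, ‖z.ofLp‖ ^ 2 := Finset.sum_le_sum fun i _ => hle i
      _ = 3 * ‖z.ofLp‖ ^ 2 := by simp
      _ ≤ (2 * ‖z.ofLp‖) ^ 2 := by nlinarith [norm_nonneg z.ofLp]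
  exact (pow_le_pow_iff_left₀ (norm_nonneg _) (by positivity) two_ne_zero).1 h3

/-! ### Orthogonal matrices act as linear isometries of `EuclideanSpace ℝ (Fin 3)` -/

/-- An orthogonal `3 × 3` real matrix `R` (`Matrix.orthogonalGroup`) induces a linear isometry `T` of
`EuclideanSpace ℝ (Fin 3)` acting by `R` on coordinates: `Rᵀ R = 1` preserves the dot product.
[folklore] -/
theorem exists_linearIsometryEquiv_of_orthogonal (R : Matrix.orthogonalGroup (Fin 3) ℝ) :
    ∃ T : EuclideanSpace ℝ (Fin 3) ≃ₗᵢ[ℝ] EuclideanSpace ℝ (Fin 3),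
      ∀ y : EuclideanSpace ℝ (Fin 3), (T y).ofLp = R.1.mulVec y.ofLp := by
  have hR : R.1.transpose * R.1 = 1 := (Matrix.mem_orthogonalGroup_iff' (Fin 3) ℝ).1 R.2
  set f : EuclideanSpace ℝ (Fin 3) →ₗ[ℝ] EuclideanSpace ℝ (Fin 3) := Matrix.toEuclideanLin R.1
    with hf
  have hf_apply : ∀ y : EuclideanSpace ℝ (Fin 3), (f y).ofLp = R.1.mulVec y.ofLp := fun y => by
    rw [hf, Matrix.toLpLin_apply]
  have hinner : ∀ x y : EuclideanSpace ℝ (Fin 3), inner ℝ (f x) (f y) = inner ℝ x y := by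
    intro x y
    rw [EuclideanSpace.inner_eq_star_dotProduct, EuclideanSpace.inner_eq_star_dotProduct,
      star_trivial, star_trivial, hf_apply, hf_apply, Matrix.dotProduct_mulVec,
      ← Matrix.mulVec_transpose, Matrix.mulVec_mulVec, hR, Matrix.one_mulVec]
  refine ⟨(f.isometryOfInner hinner).toLinearIsometryEquiv rfl, fun y => ?_⟩
  exact hf_apply y

/-! ### Lattice sums are integrals of step functions -/

/-- The lattice approximation `y ↦ [y/δ]` is measurable. [folklore] -/
theorem measurable_latticeApprox (δ : ℝ) :
    Measurable (latticeApprox δ : EuclideanSpace ℝ (Fin 3) → Site 3) := by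
  refine measurable_pi_lambda _ fun i => ?_
  have hc : Measurable fun y : EuclideanSpace ℝ (Fin 3) => y i / δ :=
    ((EuclideanSpace.proj i).continuous.measurable).div_const δ
  exact Int.measurable_floor.comp hc

/-- The cell `{y | [y/δ] = x}` is the half-open cube `∏ᵢ [δxᵢ, δxᵢ + δ)` (pulled back along the
coordinate map), `δ > 0`. [folklore] -/
theorem cell_eq_preimage_pi {δ : ℝ} (hδ : 0 < δ) (x : Site 3) :
    {y : EuclideanSpace ℝ (Fin 3) | latticeApprox δ y = x} =
      (fun y : EuclideanSpace ℝ (Fin 3) => y.ofLp) ⁻¹'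
        Set.pi Set.univ (fun i => Ico (δ * (x i : ℝ)) (δ * (x i : ℝ) + δ)) := by
  ext y
  simp only [mem_setOf_eq, mem_preimage, Set.mem_univ_pi, mem_Ico]
  constructor
  · intro h i
    have hi : ⌊y i / δ⌋ = x i := by rw [← h]; rfl
    rw [Int.floor_eq_iff, le_div_iff₀ hδ, div_lt_iff₀ hδ] at hi
    change δ * (x i : ℝ) ≤ y i ∧ y i < δ * (x i : ℝ) + δ
    constructor <;> nlinarith [hi.1, hi.2]
  · intro h
    funext i
    rw [latticeApprox_apply, Int.floor_eq_iff, le_div_iff₀ hδ, div_lt_iff₀ hδ]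
    have h1 := (h i).1
    have h2 := (h i).2
    change δ * (x i : ℝ) ≤ y i at h1
    change y i < δ * (x i : ℝ) + δ at h2
    constructor <;> nlinarith [h1, h2]

/-- The cell `{[y/δ] = x}` has volume `δ³` (`δ > 0`). [folklore] -/
theorem volume_cell {δ : ℝ} (hδ : 0 < δ) (x : Site 3) :
    volume {y : EuclideanSpace ℝ (Fin 3) | latticeApprox δ y = x} = ENNReal.ofReal δ ^ 3 := by
  rw [cell_eq_preimage_pi hδ x,
    (PiLp.volume_preserving_ofLp (Fin 3)).measure_preimage
      (MeasurableSet.univ_pi fun i => measurableSet_Ico).nullMeasurableSet,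
    volume_pi_pi]
  simp only [Real.volume_Ico, add_sub_cancel_left, Finset.prod_const, Finset.card_univ,
    Fintype.card_fin]

/-- The cell `{[y/δ] = x}` is measurable. [folklore] -/
theorem measurableSet_cell (δ : ℝ) (x : Site 3) :
    MeasurableSet {y : EuclideanSpace ℝ (Fin 3) | latticeApprox δ y = x} :=
  measurable_latticeApprox δ (measurableSet_singleton x)

/-- **Lattice sums as integrals of step functions**: for a finitely supported `F : ℤ³ → ℝ` and
`δ > 0`, `∫_{ℝ³} F([y/δ]) dy = δ³ Σ_x F(x)`. [cite: Folland1999, Thm. 2.26] -/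
theorem integral_comp_latticeApprox {δ : ℝ} (hδ : 0 < δ) (F : Site 3 → ℝ) (s : Finset (Site 3))
    (hF : ∀ x ∉ s, F x = 0) :
    ∫ y : EuclideanSpace ℝ (Fin 3), F (latticeApprox δ y) = δ ^ 3 * ∑ x ∈ s, F x := by
  classical
  set cell : Site 3 → Set (EuclideanSpace ℝ (Fin 3)) := fun x => {y | latticeApprox δ y = x}
    with hcell
  have hrepr : (fun y : EuclideanSpace ℝ (Fin 3) => F (latticeApprox δ y)) =
      fun y => ∑ x ∈ s, (cell x).indicator (fun _ => F x) y := by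
    funext y
    by_cases hy : latticeApprox δ y ∈ s
    · rw [Finset.sum_eq_single_of_mem _ hy]
      · rw [indicator_of_mem]
        exact rfl
      · intro x _ hx
        rw [indicator_of_notMem]
        exact fun h => hx h.symm
    · rw [hF _ hy]
      refine (Finset.sum_eq_zero fun x hx => ?_).symm
      rw [indicator_of_notMem]
      intro h
      exact hy (h ▸ hx)
  rw [hrepr, integral_finsetSum]
  · rw [Finset.mul_sum]
    refine Finset.sum_congr rfl fun x _ => ?_
    rw [integral_indicator_const _ (measurableSet_cell δ x), smul_eq_mul, Measure.real,
      show volume (cell x) = ENNReal.ofReal δ ^ 3 from volume_cell hδ x, ENNReal.toReal_pow,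
      ENNReal.toReal_ofReal hδ.le]
  · intro x _
    refine IntegrableOn.integrable_indicator ?_ (measurableSet_cell δ x)
    refine integrableOn_const ?_
    rw [show volume (cell x) = ENNReal.ofReal δ ^ 3 from volume_cell hδ x]
    exact ENNReal.pow_ne_top ENNReal.ofReal_ne_top

/-- **Rescaled lattice sums as integrals**: if `Ψ : ℝ³ → ℝ` vanishes outside the ball of radius `M`,
then for every `g : ℤ³ → ℝ` and `δ > 0`,
`δ³ Σ_{x ∈ ℤ³} Ψ(δx) g(x) = ∫_{ℝ³} Ψ(δ[y/δ]) g([y/δ]) dy`. [cite: Folland1999, Thm. 2.26] -/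
theorem cube_mul_tsum_eq_integral {Ψ : EuclideanSpace ℝ (Fin 3) → ℝ} {M δ : ℝ} (hδ : 0 < δ)
    (hΨ : ∀ y, M < ‖y‖ → Ψ y = 0) (g : Site 3 → ℝ) :
    δ ^ 3 * ∑' x : Site 3, Ψ (δ • siteVec x) * g x =
      ∫ y : EuclideanSpace ℝ (Fin 3),
        Ψ (δ • siteVec (latticeApprox δ y)) * g (latticeApprox δ y) := by
  set F : Site 3 → ℝ := fun x => Ψ (δ • siteVec x) * g x with hF
  have hzero : ∀ x, ⌈M / δ⌉₊ < Site.supNorm x → F x = 0 := fun x hx => by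
    show Ψ (δ • siteVec x) * g x = 0
    rw [sample_eq_zero_of_supNorm_lt hδ hΨ x hx, zero_mul]
  have h1 : ∑' x : Site 3, Ψ (δ • siteVec x) * g x = ∑ x ∈ box 3 ⌈M / δ⌉₊, F x :=
    tsum_eq_sum_box hzero
  have h2 := integral_comp_latticeApprox hδ F (box 3 ⌈M / δ⌉₊) fun x hx =>
    hzero x (by rwa [mem_box_iff_supNorm_le, not_le] at hx)
  rw [h1, ← h2]

/-- Summability of the sampled products `x ↦ Ψ(δx) g(x)` for `Ψ` vanishing outside a ball, `δ > 0`.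
[folklore] -/
theorem summable_sample_mul {Ψ : EuclideanSpace ℝ (Fin 3) → ℝ} {M δ : ℝ} (hδ : 0 < δ)
    (hΨ : ∀ y, M < ‖y‖ → Ψ y = 0) (g : Site 3 → ℝ) :
    Summable fun x : Site 3 => Ψ (δ • siteVec x) * g x :=
  summable_of_box (N := ⌈M / δ⌉₊) fun x hx => by
    show Ψ (δ • siteVec x) * g x = 0
    rw [sample_eq_zero_of_supNorm_lt hδ hΨ x hx, zero_mul]

end Summit.CriticalPhenomena.Ising3DConformalLimit.HarmonicMomentsIsotropyTwoPoint

end
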